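import Mathlib
import HarnessLib
import Literature.MathematicalPhysics.StatisticalMechanics.InitialPolymerActivity
import Literature.MathematicalPhysics.StatisticalMechanics.PolymerProductABKM
import Literature.MathematicalPhysics.StatisticalMechanics.StrongNormExpLipschitz

/-!
# The initial activity `K̂_0(𝒦, ℋ) = e^{−ℋ} 𝒦` of the fine tuning ([ABKM19] (12.8)), the entry
# estimate of Lemma 12.3 for general `d`, and the scale-`0` weight inequality of Lemma 12.5

[ABKM19] Ch. 12 runs the fine tuning of the relevant Hamiltonian on the family of problems
`∫ (e^{−H_0} ∘ K̂_0(ℋ, 𝒦)) dμ^{(q(ℋ))}`, `K̂_0(ℋ, 𝒦) = e^{−ℋ}𝒦` (p. 28), i.e. with the scale-`0`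
irrelevant coordinate ((12.8))

`K̂_0(𝒦, ℋ)(X, φ) = exp(−ℋ(X, φ)) ∏_{x ∈ X} 𝒦(∇φ(x))`.

The second fixed point (Lemma 12.6, in the tree `RGFlow.exists_isTunedQ_initial_eq`) needs the map
`ℋ ↦ K̂_0(𝒦, ℋ)` into the scale-`0` activities to be bounded and Lipschitz in the weak norm
`‖·‖_0^{(A)}` ([ABKM19] Lemma 12.2; `InitialActivityHamiltonianNorm.lean`).  This file supplies the
objects and the two analytic inputs of that lemma which are specific to scale `0`, for COMPLEX `𝒦` in
the ball `‖D^s𝒦(z)‖ ≤ ρ e^{|z|²/4}` (`s ≤ r₀`) of `E_{ζ,𝒬}`, `ζ = ½`, `𝒬 = |·|²` (multilinear operator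
norms; the `ι`-symmetry of the crux line plays no role for norms):

* `tayNorm_comp_gradAt_le_of_bound`, **`tayNorm_initK_le`** — Lemma 12.3 (12.17)–(12.18) for
  general `d`: `‖∏_{x∈X}𝒦(∇·(x))‖_{T_φ} ≤ (ρ e^{𝔥/R})^{|X|} exp(¼ Σ_{x∈X}|∇φ(x)|²)` (the constant
  `e^{𝔥/R}` replaces `2^{R₀}dr₀h^{r₀}` because the ball bounds operator norms of `D^s𝒦` rather than
  `Σ_γ|∂^γ𝒦|/γ!`);
* `dotProduct_derivForm_unitIndices_setInd`, **`exp_quarter_mul_expWeight_le_weight_zero`** — the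
  scale-`0` weight inequality `e^{¼Σ_{x∈X}|∇φ(x)|²} · W_0^X(φ) ≤ w_0^X(φ)` of the proof of Lemma 12.5
  (`w_0^X ≥ w_{-1:0}^X ∏_{B∈𝓑_0(X)} W_0^B`, from the seed `A_0^X = ½Σ_i∇_iᵀ1_X∇_i + (δ₀/θ_max)M_0^{χ_X}`
  of `abkmWeightData` and any strong coefficient `g ≤ δ₀/θ_max`);
* **`initKH 𝒦 H`** — `K̂_0(𝒦, ℋ)` ((12.8)); `initKH_union`, `factorises_initKH`, `transInv_initKH`,
  `contDiff_initKH`, `isGaugeLocal_initKH`, `initKH_sub`;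
* `numBlocks_pow_zero`, `card_blocks_pow_zero` (`|X|_0 = |X|`), and the elementary inequalities
  `succ_mul_pow_le_one_of_le_half` (`(n+1)xⁿ ≤ 1` for `x ≤ ½`) used for the constants of Lemma 12.2
  (the companion `(a+δ)^{n+1} − a^{n+1} ≤ (n+1)δ(a+δ)ⁿ` is `RenormalisationMapSmallness.add_pow_succ_sub_pow_succ_le`).

Everything is proved; no named fact.

## References
* S. Adams, S. Buchholz, R. Kotecký, S. Müller, arXiv:1910.13564, Ch. 4 (p. 28), Ch. 12.1 (12.8),
  Lemma 12.3 (12.15)–(12.18), Lemma 12.5 (proof), (12.19)–(12.20) [AdamsBuchholzKoteckyMuller2019].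
-/

noncomputable section

namespace Literature.MathematicalPhysics.StatisticalMechanics.GradientRG

open scoped BigOperators Classical
open Finset Matrix
open Literature.MathematicalPhysics.StatisticalMechanics.TorusPolymer
  (IsPolymer blocks bprod blockOf thicken numBlocks mem_blocks subset_thicken thicken_mono
    isPolymer_empty card_blocks_eq_numBlocks)
open Literature.Barriers.CriticalPhenomena.LongRangePhi4.Polymer (IsConn)
open Literature.MathematicalPhysics.StatisticalMechanics.GradientFRD (iterDiff)
open Literature.MathematicalPhysics.QuantumFieldTheory

variable {d M : ℕ} [NeZero M]

/-! ## Lemma 12.3 for general `d`: the initial activity in the `T_φ` norms -/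

/-- **Single-site entry estimate** ([ABKM19] (12.17)): if `‖D^s𝒦(z)‖ ≤ ρ e^{|z|²/4}` for `s ≤ r₀` then
for `x ∈ S`, `𝔥, R > 0`, `p ≥ 1`: `‖𝒦(∇·(x))‖_{T_φ} ≤ ρ e^{𝔥/R} e^{¼|∇φ(x)|²}` (gauge `T_{𝔥,R,p,S}`).
[cite: AdamsBuchholzKoteckyMuller2019, Lemma 12.3 (12.17)] -/
theorem tayNorm_comp_gradAt_le_of_bound {r₀ : ℕ} {ρ : ℝ} {𝒦 : (Fin d → ℝ) → ℂ}
    (h𝒦 : ContDiff ℝ r₀ 𝒦)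
    (h𝒦b : ∀ k, k ≤ r₀ → ∀ z : Fin d → ℝ, ‖iteratedFDeriv ℝ k 𝒦 z‖ ≤ ρ * Real.exp ((∑ i, z i ^ 2) / 4))
    {𝔥 R : ℝ} (h𝔥 : 0 < 𝔥) (hR : 0 < R) {p : ℕ} (hp : 1 ≤ p) {S : Finset (Fin d → ZMod M)}
    {x : Fin d → ZMod M} (hx : x ∈ S) (φ : (Fin d → ZMod M) → ℝ) :
    tayNorm (fieldGauge 𝔥 R p S) r₀ (fun φ : (Fin d → ZMod M) → ℝ => 𝒦 (gradAt x φ)) φ ≤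
      ρ * Real.exp (𝔥 / R) * Real.exp ((∑ i, (gradAt x φ i) ^ 2) / 4) := by
  have hρ : 0 ≤ ρ := by
    have h0 := (norm_nonneg _).trans (h𝒦b 0 (Nat.zero_le _) 0)
    exact (mul_nonneg_iff_of_pos_right (Real.exp_pos _)).1 h0
  set w : ℝ := Real.exp ((∑ i, (gradAt x φ i) ^ 2) / 4) with hw
  have hw0 : 0 ≤ w := (Real.exp_pos _).le
  have ht : 0 ≤ 𝔥 / R := div_nonneg h𝔥.le hR.le
  refine (tayNorm_comp_gradAt_le h𝔥 hR hp hx h𝒦 φ).trans ?_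
  calc ∑ s ∈ Finset.range (r₀ + 1),
        ((s.factorial : ℝ)⁻¹) * (‖iteratedFDeriv ℝ s 𝒦 (gradAt x φ)‖ * (𝔥 / R) ^ s)
      ≤ ∑ s ∈ Finset.range (r₀ + 1), ((s.factorial : ℝ)⁻¹) * ((ρ * w) * (𝔥 / R) ^ s) := by
        refine Finset.sum_le_sum fun s hs => ?_
        have hs' : s ≤ r₀ := Nat.lt_succ_iff.1 (Finset.mem_range.1 hs)
        refine mul_le_mul_of_nonneg_left ?_ (inv_nonneg.2 (Nat.cast_nonneg _))
        refine mul_le_mul_of_nonneg_right ?_ (pow_nonneg ht _)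
        exact h𝒦b s hs' (gradAt x φ)
    _ = (ρ * w) * ∑ s ∈ Finset.range (r₀ + 1), (𝔥 / R) ^ s / (s.factorial : ℝ) := by
        rw [Finset.mul_sum]
        refine Finset.sum_congr rfl fun s _ => ?_
        rw [div_eq_mul_inv]; ring
    _ ≤ (ρ * w) * Real.exp (𝔥 / R) :=
        mul_le_mul_of_nonneg_left (Real.sum_le_exp_of_nonneg ht (r₀ + 1)) (mul_nonneg hρ hw0)
    _ = ρ * Real.exp (𝔥 / R) * w := by ring

/-- `K_0(X, ·) = ∏_{x∈X} 𝒦(∇·(x))` is `C^{r₀}` for `C^{r₀}` `𝒦`. [cite: AdamsBuchholzKoteckyMuller2019, Lemma 12.3] -/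
theorem contDiff_initK {n : ℕ} {𝒦 : (Fin d → ℝ) → ℂ} (h𝒦 : ContDiff ℝ n 𝒦) (X : Finset (Fin d → ZMod M)) :
    ContDiff ℝ n (initK 𝒦 X) := by
  have hfun : initK 𝒦 X = fun φ : (Fin d → ZMod M) → ℝ => ∏ x ∈ X, 𝒦 (gradAt x φ) := rfl
  rw [hfun]
  exact contDiff_prod fun x _ => h𝒦.comp (LinearMap.toContinuousLinearMap (gradAt x)).contDiff

/-- **Entry estimate for the polymer activity** ([ABKM19] (12.18)), general `d`: for `X ⊆ S`,
`‖∏_{x∈X} 𝒦(∇·(x))‖_{T_φ} ≤ (ρ e^{𝔥/R})^{|X|} exp(¼ Σ_{x∈X} |∇φ(x)|²)` — the weighted bound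
`‖I(𝒦)(X)‖_{T_φ}/w_{-1:0}^X(φ) ≤ (ρe^{𝔥/R})^{|X|}` with `w_{-1:0}^X = e^{½(1−ζ)Σ_{x∈X}𝒬(∇φ(x))}`, `ζ = ½`.
[cite: AdamsBuchholzKoteckyMuller2019, Lemma 12.3 (12.18)] -/
theorem tayNorm_initK_le {r₀ : ℕ} {ρ : ℝ} {𝒦 : (Fin d → ℝ) → ℂ} (h𝒦 : ContDiff ℝ r₀ 𝒦)
    (h𝒦b : ∀ k, k ≤ r₀ → ∀ z : Fin d → ℝ, ‖iteratedFDeriv ℝ k 𝒦 z‖ ≤ ρ * Real.exp ((∑ i, z i ^ 2) / 4))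
    {𝔥 R : ℝ} (h𝔥 : 0 < 𝔥) (hR : 0 < R) {p : ℕ} (hp : 1 ≤ p) {S X : Finset (Fin d → ZMod M)}
    (hXS : X ⊆ S) (φ : (Fin d → ZMod M) → ℝ) :
    tayNorm (fieldGauge 𝔥 R p S) r₀ (initK 𝒦 X) φ ≤
      (ρ * Real.exp (𝔥 / R)) ^ X.card * Real.exp ((∑ x ∈ X, ∑ i, (gradAt x φ i) ^ 2) / 4) := by
  have hdiff : ∀ x ∈ X, ContDiff ℝ r₀ (fun φ : (Fin d → ZMod M) → ℝ => 𝒦 (gradAt x φ)) :=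
    fun x _ => h𝒦.comp (LinearMap.toContinuousLinearMap (gradAt x)).contDiff
  have hfun : initK 𝒦 X = fun φ : (Fin d → ZMod M) → ℝ => ∏ x ∈ X, 𝒦 (gradAt x φ) := rfl
  rw [hfun]
  refine (tayNorm_prod_le (fieldGauge 𝔥 R p S) X hdiff φ).trans ?_
  calc ∏ x ∈ X, tayNorm (fieldGauge 𝔥 R p S) r₀ (fun φ : (Fin d → ZMod M) → ℝ => 𝒦 (gradAt x φ)) φ
      ≤ ∏ x ∈ X, (ρ * Real.exp (𝔥 / R) * Real.exp ((∑ i, (gradAt x φ i) ^ 2) / 4)) :=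
        Finset.prod_le_prod (fun x _ => tayNorm_nonneg _ _ _ _)
          fun x hx => tayNorm_comp_gradAt_le_of_bound h𝒦 h𝒦b h𝔥 hR hp (hXS hx) φ
    _ = (ρ * Real.exp (𝔥 / R)) ^ X.card * Real.exp ((∑ x ∈ X, ∑ i, (gradAt x φ i) ^ 2) / 4) := by
        rw [Finset.prod_mul_distrib, Finset.prod_const, ← Real.exp_sum, Finset.sum_div]

/-! ## The scale-`0` weight inequality of the proof of Lemma 12.5 -/

/-- `(φ, Σ_i ∇_iᵀ 1_X ∇_i φ) = Σ_{x∈X} Σ_i (∇_iφ(x))²` (the gradient part of the seed `A_0^X`).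
[cite: AdamsBuchholzKoteckyMuller2019, Ch. 7.1 (7.5)] -/
theorem dotProduct_derivForm_unitIndices_setInd (L : ℝ) (X : Finset (Fin d → ZMod M))
    (φ : (Fin d → ZMod M) → ℝ) :
    φ ⬝ᵥ derivForm L 0 (unitIndices d) (setInd X) *ᵥ φ = ∑ x ∈ X, ∑ i, (gradAt x φ i) ^ 2 := by
  rw [dotProduct_derivForm_mulVec]
  unfold unitIndices
  have hinj : Set.InjOn (fun i : Fin d => (Pi.single i 1 : Fin d → ℕ)) ↑(Finset.univ : Finset (Fin d)) :=
    fun i _ j _ h => by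
      by_contra hij
      have := congrFun h i
      simp only [Pi.single_eq_same, Pi.single_apply, if_neg hij] at this
      exact one_ne_zero this
  rw [sum_image hinj, Finset.sum_comm]
  refine sum_congr rfl fun i _ => ?_
  have h1 : L ^ (2 * 0 * (∑ j, (Pi.single i 1 : Fin d → ℕ) j - 1)) = 1 := by
    rw [mul_zero, zero_mul, pow_zero]
  rw [h1, one_mul, iterDiff_single]
  simp only [setInd, boole_mul, gradAt_apply]
  rw [Finset.sum_ite_mem, Finset.univ_inter]

/-- **`e^{¼Σ_{x∈X}|∇φ(x)|²} · W_0^X(φ) ≤ w_0^X(φ)`** for the torus weight data, where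
`W_0^X = expWeight (g • derivForm L 0 s χ_0^X)` is the strong weight at scale `0` with any coefficient
`g ≤ δ'_0/θ_max` (in [ABKM19]: `g_0 = h^{−2} ≤ δ/θ_max` by (12.19), and
`(φ, A_0^Xφ) ≥ (1−ζ)Σ_{x∈X}𝒬(∇φ(x)) + (φ, G_0^Xφ)`, proof of Lemma 12.5).
[cite: AdamsBuchholzKoteckyMuller2019, Lemma 12.5 (proof)] -/
theorem exp_quarter_mul_expWeight_le_weight_zero {L N Mord R : ℕ} {θbar : ℝ} {δ' : ℕ → ℝ}
    {𝒞 : ℕ → (Fin d → ZMod M) → ℝ} {g : ℝ} (hg : g ≤ δ' 0 / thetaMax R d)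
    (X : Finset (Fin d → ZMod M)) (φ : (Fin d → ZMod M) → ℝ) :
    Real.exp ((∑ x ∈ X, ∑ i, (gradAt x φ i) ^ 2) / 4) *
        expWeight (g • derivForm (L : ℝ) 0 (diffIndex d Mord)
          (boxDensity (boxRad R L 0) (boxWt (L : ℝ) d 0) X)) φ ≤
      (abkmWeightData L N Mord R θbar δ' 𝒞).weight 0 X φ := by
  have hL : (0 : ℝ) ≤ (L : ℝ) := Nat.cast_nonneg L
  rw [WeightData.weight_eq_expWeight, WeightData.form_zero]
  have hseed : (abkmWeightData L N Mord R θbar δ' 𝒞).seed X =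
      (1 / 2 : ℝ) • derivForm (L : ℝ) 0 (unitIndices d) (setInd X) +
        (δ' 0 / thetaMax R d) • derivForm (L : ℝ) 0 (diffIndex d Mord)
          (boxDensity (boxRad R L 0) (boxWt (L : ℝ) d 0) X) := by
    unfold abkmWeightData
    rw [geomWeightData_seed]
  have h1 : Real.exp ((∑ x ∈ X, ∑ i, (gradAt x φ i) ^ 2) / 4) =
      expWeight ((1 / 2 : ℝ) • derivForm (L : ℝ) 0 (unitIndices d) (setInd X)) φ := by
    rw [expWeight, Matrix.smul_mulVec, dotProduct_smul, dotProduct_derivForm_unitIndices_setInd,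
      smul_eq_mul]
    congr 1; ring
  rw [h1, ← expWeight_add]
  refine expWeight_mono ?_ φ
  have hsub : (abkmWeightData L N Mord R θbar δ' 𝒞).seed X -
      ((1 / 2 : ℝ) • derivForm (L : ℝ) 0 (unitIndices d) (setInd X) +
        g • derivForm (L : ℝ) 0 (diffIndex d Mord) (boxDensity (boxRad R L 0) (boxWt (L : ℝ) d 0) X)) =
      (δ' 0 / thetaMax R d - g) • derivForm (L : ℝ) 0 (diffIndex d Mord)
        (boxDensity (boxRad R L 0) (boxWt (L : ℝ) d 0) X) := by
    rw [hseed, sub_smul]; abel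
  rw [hsub]
  exact (posSemidef_derivForm hL 0 (diffIndex d Mord)
    (fun x => boxDensity_nonneg _ (by unfold boxWt; positivity) X x)).smul (sub_nonneg.2 hg)

/-! ## `K̂_0(𝒦, ℋ)` -/

/-- **`K̂_0(𝒦, ℋ)(X, φ) = e^{−ℋ(X, φ)} ∏_{x∈X} 𝒦(∇φ(x))`** — the scale-`0` irrelevant coordinate of the
fine-tuning problem with relevant seed `ℋ` ([ABKM19] (12.8); p. 28: `K̂_0(ℋ, 𝒦) = e^{−ℋ}𝒦`).
[cite: AdamsBuchholzKoteckyMuller2019, Ch. 12.1 (12.8)] -/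
def initKH (𝒦 : (Fin d → ℝ) → ℂ) (H : RelevantHamiltonian ℂ d) (X : Finset (Fin d → ZMod M))
    (φ : (Fin d → ZMod M) → ℝ) : ℂ :=
  expNegH H X φ * initK 𝒦 X φ

section Basic

variable (𝒦 : (Fin d → ℝ) → ℂ) (H : RelevantHamiltonian ℂ d)

omit [NeZero M] in
/-- Unfolding. [cite: AdamsBuchholzKoteckyMuller2019, Ch. 12.1 (12.8)] -/
theorem initKH_apply (X : Finset (Fin d → ZMod M)) (φ : (Fin d → ZMod M) → ℝ) :
    initKH 𝒦 H X φ = expNegH H X φ * initK 𝒦 X φ := rfl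

omit [NeZero M] in
/-- At `ℋ = 0` the initial activity is `K_0 = ∏ 𝒦(∇φ(x))` ((4.2)). [cite: AdamsBuchholzKoteckyMuller2019, Ch. 4.1 (4.2)] -/
theorem initKH_zero_ham : initKH (M := M) 𝒦 0 = initK 𝒦 := by
  funext X φ
  rw [initKH_apply, expNegH_zero, one_mul]

omit [NeZero M] in
/-- `K̂_0(𝒦, ℋ)(∅) = 1`. [cite: AdamsBuchholzKoteckyMuller2019, Ch. 12.1 (12.8)] -/
@[simp] theorem initKH_empty (φ : (Fin d → ZMod M) → ℝ) : initKH 𝒦 H ∅ φ = 1 := by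
  rw [initKH_apply, initK_empty, mul_one]
  unfold expNegH
  rw [eval_empty, neg_zero, Complex.exp_zero]

omit [NeZero M] in
/-- **`K̂_0(𝒦, ℋ)` factorises over disjoint unions** (both `e^{−ℋ(X)}` and `∏_{x∈X}𝒦(∇φ(x))` do).
[cite: AdamsBuchholzKoteckyMuller2019, Ch. 12.1 (12.8)] -/
theorem initKH_union {X₁ X₂ : Finset (Fin d → ZMod M)} (h : Disjoint X₁ X₂) (φ : (Fin d → ZMod M) → ℝ) :
    initKH 𝒦 H (X₁ ∪ X₂) φ = initKH 𝒦 H X₁ φ * initKH 𝒦 H X₂ φ := by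
  simp only [initKH, expNegH]
  rw [eval_union H h φ, initK_union 𝒦 h φ, neg_add, Complex.exp_add]
  ring

/-- `K̂_0(𝒦, ℋ)` factorises on every scale `s ≥ 1` in the sense of `Factorises`.
[cite: AdamsBuchholzKoteckyMuller2019, Lemma 6.4 (5) (6.35) at k = 0] -/
theorem factorises_initKH (s : ℕ) : Factorises (M := M) s (initKH 𝒦 H) :=
  fun X₁ X₂ _ _ hsep φ => initKH_union 𝒦 H (hsep.disjoint (by omega)) φ

omit [NeZero M] in
/-- `K̂_0(𝒦, ℋ)` is translation invariant on every scale. [cite: AdamsBuchholzKoteckyMuller2019, Lemma 6.4 (1) at k = 0] -/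
theorem transInv_initKH (s : ℕ) : TransInv s (initKH (M := M) 𝒦 H) := by
  intro a _ X φ
  simp only [initKH, expNegH]
  rw [eval_translate_fieldShift, initK_translate]

/-- `K̂_0(𝒦, ℋ)(X, ·)` is `C^{n}` for `C^{n}` `𝒦`. [cite: AdamsBuchholzKoteckyMuller2019, Lemma 12.2] -/
theorem contDiff_initKH {n : ℕ} (h𝒦 : ContDiff ℝ n 𝒦) (X : Finset (Fin d → ZMod M)) :
    ContDiff ℝ n (initKH 𝒦 H X) := by
  have hfun : initKH 𝒦 H X = fun φ => expNegH H X φ * initK 𝒦 X φ := rfl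
  rw [hfun]
  exact ((contDiff_eval H X (n := n)).neg.cexp).mul (contDiff_initK h𝒦 X)

/-- `K̂_0(𝒦, ℋ)(X, ·)` is local for the gauge `T_{𝔥,R,p,S}` whenever `X ⊆ S` (`p ≥ ⌊d/2⌋+1`).
[cite: AdamsBuchholzKoteckyMuller2019, Lemma 12.2] -/
theorem isGaugeLocal_initKH {𝔥 R : ℝ} (h𝔥 : 0 < 𝔥) (hR : 0 < R) {p : ℕ} (hp : d / 2 + 1 ≤ p)
    {S X : Finset (Fin d → ZMod M)} (hXS : X ⊆ S) :
    IsGaugeLocal (fieldGauge 𝔥 R p S) (initKH 𝒦 H X) := by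
  have hfun : initKH 𝒦 H X = (fun φ => expNegH H X φ) * initK 𝒦 X := rfl
  rw [hfun]
  exact (isGaugeLocal_cexp_neg_eval h𝔥.ne' hR.ne' hp hXS H).mul
    (isGaugeLocal_initK 𝒦 h𝔥 hR (le_trans (by omega) hp) hXS)

omit [NeZero M] in
/-- `K̂_0(𝒦, ℋ)(X) − K̂_0(𝒦, ℋ')(X) = (e^{−ℋ(X)} − e^{−ℋ'(X)}) ∏_{x∈X}𝒦(∇φ(x))`.
[cite: AdamsBuchholzKoteckyMuller2019, Lemma 12.5 (P_4 is linear in K)] -/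
theorem initKH_sub (H' : RelevantHamiltonian ℂ d) (X : Finset (Fin d → ZMod M)) (φ : (Fin d → ZMod M) → ℝ) :
    initKH 𝒦 H X φ - initKH 𝒦 H' X φ = (expNegH H X φ - expNegH H' X φ) * initK 𝒦 X φ := by
  simp only [initKH]; ring

end Basic

/-! ## Elementary inequalities for the constants -/

/-- `|X|_0 = |X|`: at block side `L^0 = 1` the number of blocks of `X` is its number of sites.
[cite: AdamsBuchholzKoteckyMuller2019, Ch. 6.2 (𝓑_0 = Λ)] -/
theorem numBlocks_pow_zero (L : ℕ) (X : Finset (Fin d → ZMod M)) : numBlocks (L ^ 0) X = X.card := by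
  rw [pow_zero, ← card_blocks_eq_numBlocks, blocks_one,
    Finset.card_image_of_injective _ Finset.singleton_injective]

/-- The number of scale-`0` blocks of `X` is `|X|`. [cite: AdamsBuchholzKoteckyMuller2019, Ch. 6.2 (𝓑_0 = Λ)] -/
theorem card_blocks_pow_zero (L : ℕ) (X : Finset (Fin d → ZMod M)) : (blocks (L ^ 0) X).card = X.card := by
  rw [card_blocks_eq_numBlocks, numBlocks_pow_zero]

omit [NeZero M] in
/-- `(n+1) x^n ≤ 1` for `0 ≤ x ≤ ½` (the combinatorial factor `|X|` of a derivative against the gain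
`2^{−|X|}`, cf. [ABKM19] (12.20)). [cite: AdamsBuchholzKoteckyMuller2019, Lemma 12.3 (12.20)] -/
theorem succ_mul_pow_le_one_of_le_half {x : ℝ} (hx0 : 0 ≤ x) (hx : x ≤ 1 / 2) (n : ℕ) :
    (n + 1 : ℝ) * x ^ n ≤ 1 := by
  have h1 : (n + 1 : ℝ) ≤ 2 ^ n := by exact_mod_cast Nat.lt_two_pow_self
  have h2 : x ^ n ≤ (1 / 2) ^ n := pow_le_pow_left₀ hx0 hx n
  calc (n + 1 : ℝ) * x ^ n ≤ 2 ^ n * (1 / 2) ^ n := mul_le_mul h1 h2 (pow_nonneg hx0 n) (by positivity)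
    _ = 1 := by rw [← mul_pow]; norm_num


end Literature.MathematicalPhysics.StatisticalMechanics.GradientRG

end
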